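import Mathlib
import Summits.Ventures.PercRepro2.Defs
import Summits.Ventures.PercRepro2.Graph
import Summits.Ventures.PercRepro2.Harris
import Summits.Ventures.PercRepro2.PsiTEdge
import Summits.Ventures.PercRepro2.RowC1PendZ
import Summits.Ventures.PercRepro2.RowC1PendZTwoEdge

/-!
# (Z″) on the tight family «b adjacent only to a₂ and v» (blind cell PercRepro2, p2 g35;
proofs/P2-G35-PENDZ.md §7)

If the mark `b` has exactly the two edges `e₁ = a₂b` (weight `β`) and `e₂ = vb` (weight `δ`), the
pendant-root quantity `zpp` of `RowC1PendZ` has the closed form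
`zpp = (1 − β) δ (1 + β − βδ) (1 − βδ) · P₀(v ↮ a₂) · Cov₀(E₀, F₀)` with `P₀` the law with both
edges closed, `E₀ = {o ↔ a₂} ∪ {o ↔ v}`, `F₀ = {v ↔ a₂}`; every factor is `≥ 0`, the last by Harris
(`zpp_two_edge_eq`, `zpp_two_edge_nonneg`).  The proof peels the two edges (`prob_eq_pin` twice),
identifies the events in each pin state (`conn_iff_of_two_edges` / `conn_iff_deadend` /
`not_conn_of_two_edges_closed`) and transfers masses with
`prob_update_one_eq_prob_update_zero_of_respects`.  Std axioms.
-/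

namespace Summit.Ventures.PercRepro2

namespace RowC1

section TwoEdgeThm

variable {V : Type*} {E : Type*} [Fintype E] [DecidableEq E]
  {R : Type*} [Field R] [LinearOrder R] [IsStrictOrderedRing R]

omit [Fintype E] in
/-- With `e₂` closed, opening or closing `e₁` does not change connections among vertices `≠ b`. -/
lemma conn_update_e₁_iff (ends : E → Sym2 V) (e₁ e₂ : E) (a₂ v b x y : V)
    (h1 : ends e₁ = s(a₂, b)) (h2 : ends e₂ = s(v, b)) (hdeg : ∀ e, b ∈ ends e → e = e₁ ∨ e = e₂)
    (he : e₁ ≠ e₂) (hxb : x ≠ b) (hyb : y ≠ b) (ω : Config E) (hc : ω e₂ = false) :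
    Conn ends (Function.update ω e₁ true) x y ↔ Conn ends (Function.update ω e₁ false) x y := by
  have h := conn_iff_deadend ends e₁ e₂ a₂ v b x y h1 h2 hdeg he hxb hyb
    (Function.update ω e₁ true) (by simp [Function.update_of_ne he.symm, hc])
  rwa [Function.update_idem] at h

omit [Fintype E] in
/-- With `e₁` closed, opening or closing `e₂` does not change connections among vertices `≠ b`. -/
lemma conn_update_e₂_iff (ends : E → Sym2 V) (e₁ e₂ : E) (a₂ v b x y : V)
    (h1 : ends e₁ = s(a₂, b)) (h2 : ends e₂ = s(v, b)) (hdeg : ∀ e, b ∈ ends e → e = e₁ ∨ e = e₂)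
    (he : e₁ ≠ e₂) (hxb : x ≠ b) (hyb : y ≠ b) (ω : Config E) (hc : ω e₁ = false) :
    Conn ends (Function.update ω e₂ true) x y ↔ Conn ends (Function.update ω e₂ false) x y := by
  have h := conn_iff_deadend ends e₂ e₁ v a₂ b x y h2 h1
    (fun e hb => (hdeg e hb).symm) he.symm hxb hyb
    (Function.update ω e₂ true) (by simp [Function.update_of_ne he, hc])
  rwa [Function.update_idem] at h

omit [Fintype E] in
/-- With `e₂` open, opening `e₁` makes `a₂ ↔ o` equivalent to `a₂ ↔ o ∨ v ↔ o` with `e₁` closed. -/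
lemma conn_update_e₁_open_iff (ends : E → Sym2 V) (e₁ e₂ : E) (a₂ v b o : V)
    (h1 : ends e₁ = s(a₂, b)) (h2 : ends e₂ = s(v, b)) (hdeg : ∀ e, b ∈ ends e → e = e₁ ∨ e = e₂)
    (he : e₁ ≠ e₂) (hbo : b ≠ o) (hba : b ≠ a₂) (hbv : b ≠ v) (ω : Config E) (ho : ω e₂ = true) :
    Conn ends (Function.update ω e₁ true) a₂ o ↔
      Conn ends (Function.update ω e₁ false) a₂ o ∨ Conn ends (Function.update ω e₁ false) v o := by
  have h := conn_iff_of_two_edges ends e₁ e₂ a₂ v b o h1 h2 hdeg hbo (Function.update ω e₁ true)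
    (by simp) (by simp [Function.update_of_ne he.symm, ho])
  rw [Function.update_idem] at h
  rw [h]
  -- both sides now live with `e₁` closed; `e₂` is open on the left and closed on the right
  have hA := conn_update_e₂_iff ends e₁ e₂ a₂ v b a₂ o h1 h2 hdeg he hba.symm hbo.symm
    (Function.update ω e₁ false) (by simp)
  have hV := conn_update_e₂_iff ends e₁ e₂ a₂ v b v o h1 h2 hdeg he hbv.symm hbo.symm
    (Function.update ω e₁ false) (by simp)
  have hsame : Function.update (Function.update ω e₁ false) e₂ true =
      Function.update ω e₁ false := by
    ext e
    by_cases h : e = e₂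
    · subst h; simp [Function.update_of_ne he.symm, ho]
    · simp [Function.update_of_ne h]
  rw [hsame] at hA hV
  rw [hA, hV]

/-- Under `p[e↦1]`, an event containing `{e open}` is sure. -/
lemma prob_update_one_eq_one_of_subset (p : E → R) (hp : IsProbVec p) (e : E)
    (A : Set (Config E)) (hA : openEdge e ⊆ A) : prob (Function.update p e (1 : R)) A = 1 := by
  have hp' : IsProbVec (Function.update p e (1 : R)) := hp.update e zero_le_one le_rfl
  refine le_antisymm (prob_le_one hp' A) ?_
  calc (1 : R) = prob (Function.update p e (1 : R)) (openEdge e) := by simp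
    _ ≤ prob (Function.update p e (1 : R)) A := prob_mono hp' hA

omit [LinearOrder R] [IsStrictOrderedRing R] in
/-- Under `p[e↦1]`, intersecting with an event containing `{e open}` changes nothing. -/
lemma prob_update_one_inter_eq_of_subset (p : E → R) (e : E) (A B : Set (Config E))
    (hB : openEdge e ⊆ B) :
    prob (Function.update p e (1 : R)) (A ∩ B) = prob (Function.update p e (1 : R)) A := by
  rw [← prob_update_one_inter_openEdge p (A ∩ B) e, ← prob_update_one_inter_openEdge p A e]
  congr 1
  ext ω
  constructor
  · rintro ⟨⟨hA, _⟩, he⟩; exact ⟨hA, he⟩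
  · rintro ⟨hA, he⟩; exact ⟨⟨hA, hB he⟩, he⟩

section Pins

omit [Fintype E] [DecidableEq E] in
/-- `{a₂ ↔ b}` contains `{e₁ open}`. -/
lemma openEdge_e₁_subset_connEvent (ends : E → Sym2 V) (e₁ : E) (a₂ b : V)
    (h1 : ends e₁ = s(a₂, b)) : openEdge e₁ ⊆ connEvent ends a₂ b :=
  fun _ hω => conn_of_openAdj ⟨e₁, hω, h1⟩

omit [Fintype E] [DecidableEq E] in
/-- `{a₂ ↔ v}` contains `{e₁ open} ∩ {e₂ open}`. -/
lemma openEdge_inter_subset_connEvent (ends : E → Sym2 V) (e₁ e₂ : E) (a₂ v b : V)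
    (h1 : ends e₁ = s(a₂, b)) (h2 : ends e₂ = s(v, b)) :
    openEdge e₁ ∩ openEdge e₂ ⊆ connEvent ends a₂ v :=
  fun _ ⟨h₁, h₂⟩ => conn_trans (conn_of_openAdj ⟨e₁, h₁, h1⟩)
    (conn_of_openAdj ⟨e₂, h₂, by rw [h2, Sym2.eq_swap]⟩)

omit [LinearOrder R] [IsStrictOrderedRing R] in
/-- The **(1,0) → (0,0)** transfer, given the configuration-level equivalence. -/
lemma prob_pin10_eq_pin00 (p : E → R) (e₁ e₂ : E) (he : e₁ ≠ e₂) {A A' : Set (Config E)}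
    (hAA : ∀ ω : Config E, ω e₂ = false →
      (Function.update ω e₁ true ∈ A ↔ Function.update ω e₁ false ∈ A')) :
    prob (Function.update (Function.update p e₁ (1 : R)) e₂ (0 : R)) A =
      prob (Function.update (Function.update p e₁ (0 : R)) e₂ (0 : R)) A' := by
  rw [Function.update_comm he (1 : R) (0 : R) p, Function.update_comm he (0 : R) (0 : R) p]
  refine prob_update_one_eq_prob_update_zero_of_respects _ e₁ fun ω h0 _ => hAA ω ?_
  exact h0 e₂ he.symm (by simp)

omit [LinearOrder R] [IsStrictOrderedRing R] in
/-- The **(0,1) → (0,0)** transfer. -/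
lemma prob_pin01_eq_pin00 (p : E → R) (e₁ e₂ : E) (he : e₁ ≠ e₂) {A A' : Set (Config E)}
    (hAA : ∀ ω : Config E, ω e₁ = false →
      (Function.update ω e₂ true ∈ A ↔ Function.update ω e₂ false ∈ A')) :
    prob (Function.update (Function.update p e₁ (0 : R)) e₂ (1 : R)) A =
      prob (Function.update (Function.update p e₁ (0 : R)) e₂ (0 : R)) A' := by
  refine prob_update_one_eq_prob_update_zero_of_respects _ e₂ fun ω h0 _ => hAA ω ?_
  exact h0 e₁ he (by simp)

omit [LinearOrder R] [IsStrictOrderedRing R] in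
/-- The **(1,1) → (0,1)** transfer. -/
lemma prob_pin11_eq_pin01 (p : E → R) (e₁ e₂ : E) (he : e₁ ≠ e₂) {A A' : Set (Config E)}
    (hAA : ∀ ω : Config E, ω e₂ = true →
      (Function.update ω e₁ true ∈ A ↔ Function.update ω e₁ false ∈ A')) :
    prob (Function.update (Function.update p e₁ (1 : R)) e₂ (1 : R)) A =
      prob (Function.update (Function.update p e₁ (0 : R)) e₂ (1 : R)) A' := by
  rw [Function.update_comm he (1 : R) (1 : R) p, Function.update_comm he (0 : R) (1 : R) p]
  refine prob_update_one_eq_prob_update_zero_of_respects _ e₁ fun ω _ h1' => hAA ω ?_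
  exact h1' e₂ he.symm (by simp)

end Pins
section Masses

variable (p : E → R) (hp : IsProbVec p) (ends : E → Sym2 V) (e₁ e₂ : E) (a₂ v o b : V)

omit [LinearOrder R] [IsStrictOrderedRing R] in
/-- Pinning two edges: `P(X) = β(δ P₁₁ + (1 − δ) P₁₀) + (1 − β)(δ P₀₁ + (1 − δ) P₀₀)`. -/
lemma prob_eq_pin2 (he : e₁ ≠ e₂) (X : Set (Config E)) :
    prob p X =
      p e₁ * (p e₂ * prob (Function.update (Function.update p e₁ (1 : R)) e₂ (1 : R)) X +
          (1 - p e₂) * prob (Function.update (Function.update p e₁ (1 : R)) e₂ (0 : R)) X) +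
        (1 - p e₁) * (p e₂ * prob (Function.update (Function.update p e₁ (0 : R)) e₂ (1 : R)) X +
          (1 - p e₂) * prob (Function.update (Function.update p e₁ (0 : R)) e₂ (0 : R)) X) := by
  rw [prob_eq_pin p X e₁, prob_eq_pin (Function.update p e₁ (1 : R)) X e₂,
    prob_eq_pin (Function.update p e₁ (0 : R)) X e₂]
  simp only [Function.update_of_ne he.symm]

omit [LinearOrder R] [IsStrictOrderedRing R] in
/-- Under `p₀₀` the mark `b` is isolated: `P₀₀(a₂ ↔ b) = 0`. -/
lemma pin00_B (hdeg : ∀ e, b ∈ ends e → e = e₁ ∨ e = e₂) (he : e₁ ≠ e₂) (hba : b ≠ a₂) :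
    prob (Function.update (Function.update p e₁ (0 : R)) e₂ (0 : R)) (connEvent ends a₂ b) = 0 := by
  rw [← prob_update_zero_inter_closedEdge (Function.update p e₁ (0 : R)) _ e₂,
    Function.update_comm he (0 : R) (0 : R) p,
    ← prob_update_zero_inter_closedEdge (Function.update p e₂ (0 : R)) _ e₁]
  have hempty : connEvent ends a₂ b ∩ closedEdge e₂ ∩ closedEdge e₁ = (∅ : Set (Config E)) := by
    ext ω
    simp only [Set.mem_inter_iff, mem_connEvent, Set.mem_empty_iff_false, iff_false]
    rintro ⟨⟨hc, hc2⟩, hc1⟩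
    exact not_conn_of_two_edges_closed ends e₁ e₂ b a₂ hdeg hba ω hc1 hc2 (conn_symm hc)
  rw [hempty, prob_empty]

include hp in
/-- Under `p₁₁` an event containing `{e₁ open} ∩ {e₂ open}` is sure. -/
lemma pin11_eq_one_of_subset (he : e₁ ≠ e₂) (A : Set (Config E))
    (hA : openEdge e₁ ∩ openEdge e₂ ⊆ A) :
    prob (Function.update (Function.update p e₁ (1 : R)) e₂ (1 : R)) A = 1 := by
  have hp' : IsProbVec (Function.update (Function.update p e₁ (1 : R)) e₂ (1 : R)) :=
    (hp.update e₁ zero_le_one le_rfl).update e₂ zero_le_one le_rfl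
  refine le_antisymm (prob_le_one hp' A) ?_
  calc (1 : R) = prob (Function.update (Function.update p e₁ (1 : R)) e₂ (1 : R))
        (openEdge e₁ ∩ openEdge e₂) := by
        rw [prob_update_one_inter_openEdge, prob_openEdge, Function.update_of_ne he,
          Function.update_self]
    _ ≤ _ := prob_mono hp' hA

omit [LinearOrder R] [IsStrictOrderedRing R] in
/-- Under `p₁₁`, intersecting with an event containing `{e₁ open} ∩ {e₂ open}` changes nothing. -/
lemma pin11_inter_eq_of_subset (he : e₁ ≠ e₂) (A B : Set (Config E))
    (hB : openEdge e₁ ∩ openEdge e₂ ⊆ B) :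
    prob (Function.update (Function.update p e₁ (1 : R)) e₂ (1 : R)) (A ∩ B) =
      prob (Function.update (Function.update p e₁ (1 : R)) e₂ (1 : R)) A := by
  rw [← prob_update_one_inter_openEdge (Function.update p e₁ (1 : R)) (A ∩ B) e₂,
    ← prob_update_one_inter_openEdge (Function.update p e₁ (1 : R)) A e₂,
    Function.update_comm he (1 : R) (1 : R) p,
    ← prob_update_one_inter_openEdge (Function.update p e₂ (1 : R)) (A ∩ B ∩ openEdge e₂) e₁,
    ← prob_update_one_inter_openEdge (Function.update p e₂ (1 : R)) (A ∩ openEdge e₂) e₁]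
  congr 1
  ext ω
  constructor
  · rintro ⟨⟨⟨hA, _⟩, h2⟩, h1⟩; exact ⟨⟨hA, h2⟩, h1⟩
  · rintro ⟨⟨hA, h2⟩, h1⟩; exact ⟨⟨⟨hA, hB ⟨h1, h2⟩⟩, h2⟩, h1⟩

end Masses
section Main

variable (p : E → R) (hp : IsProbVec p) (ends : E → Sym2 V) (e₁ e₂ : E) (a₂ v o b : V)

include hp in
/-- **Closed form of `(Z″)` on the two-edge family**: if `b`'s only edges are `e₁ = a₂b` and
`e₂ = vb`, then with `P₀ = p[e₁↦0][e₂↦0]`, `s = P₀(v ↔ a₂)`, `u = P₀(o ↔ a₂, v ↔ a₂)`,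
`o₀ = P₀(o ↔ a₂)`, `r₀ = P₀(v ↮ a₂, o ↔ v)` (so `o₀ + r₀ = P₀(o ↔ {v, a₂})`):
`zpp = (1 − β) δ (1 + β − βδ) (1 − βδ) (1 − s) (u − (o₀ + r₀) s)`. -/
theorem zpp_two_edge_eq (h1 : ends e₁ = s(a₂, b)) (h2 : ends e₂ = s(v, b))
    (hdeg : ∀ e, b ∈ ends e → e = e₁ ∨ e = e₂) (he : e₁ ≠ e₂) (hbo : b ≠ o) (hba : b ≠ a₂)
    (hbv : b ≠ v) :
    zpp p ends v a₂ o b =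
      (1 - p e₁) * p e₂ * (1 + p e₁ - p e₁ * p e₂) * (1 - p e₁ * p e₂) *
        (1 - prob (Function.update (Function.update p e₁ (0 : R)) e₂ (0 : R))
          (connEvent ends a₂ v)) *
        (prob (Function.update (Function.update p e₁ (0 : R)) e₂ (0 : R))
            (connEvent ends a₂ o ∩ connEvent ends a₂ v) -
          (prob (Function.update (Function.update p e₁ (0 : R)) e₂ (0 : R)) (connEvent ends a₂ o) +
            prob (Function.update (Function.update p e₁ (0 : R)) e₂ (0 : R))
              ((connEvent ends a₂ v)ᶜ ∩ connEvent ends v o)) *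
          prob (Function.update (Function.update p e₁ (0 : R)) e₂ (0 : R))
            (connEvent ends a₂ v)) := by
  -- the four pinned vectors
  set P00 := Function.update (Function.update p e₁ (0 : R)) e₂ (0 : R) with hP00
  set P10 := Function.update (Function.update p e₁ (1 : R)) e₂ (0 : R) with hP10
  set P01 := Function.update (Function.update p e₁ (0 : R)) e₂ (1 : R) with hP01
  set P11 := Function.update (Function.update p e₁ (1 : R)) e₂ (1 : R) with hP11
  have hp00 : IsProbVec P00 := (hp.update e₁ le_rfl zero_le_one).update e₂ le_rfl zero_le_one
  have hp11 : IsProbVec P11 := (hp.update e₁ zero_le_one le_rfl).update e₂ zero_le_one le_rfl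
  -- the events
  set F := connEvent ends a₂ v with hF
  set O := connEvent ends a₂ o with hO
  set B := connEvent ends a₂ b with hB
  set W := connEvent ends v o with hW
  -- configuration-level equivalences
  have iF10 : ∀ ω : Config E, ω e₂ = false →
      (Function.update ω e₁ true ∈ F ↔ Function.update ω e₁ false ∈ F) :=
    fun ω hc => conn_update_e₁_iff ends e₁ e₂ a₂ v b a₂ v h1 h2 hdeg he hba.symm hbv.symm ω hc
  have iO10 : ∀ ω : Config E, ω e₂ = false →
      (Function.update ω e₁ true ∈ O ↔ Function.update ω e₁ false ∈ O) :=
    fun ω hc => conn_update_e₁_iff ends e₁ e₂ a₂ v b a₂ o h1 h2 hdeg he hba.symm hbo.symm ω hc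
  have iW10 : ∀ ω : Config E, ω e₂ = false →
      (Function.update ω e₁ true ∈ W ↔ Function.update ω e₁ false ∈ W) :=
    fun ω hc => conn_update_e₁_iff ends e₁ e₂ a₂ v b v o h1 h2 hdeg he hbv.symm hbo.symm ω hc
  have iF01 : ∀ ω : Config E, ω e₁ = false →
      (Function.update ω e₂ true ∈ F ↔ Function.update ω e₂ false ∈ F) :=
    fun ω hc => conn_update_e₂_iff ends e₁ e₂ a₂ v b a₂ v h1 h2 hdeg he hba.symm hbv.symm ω hc
  have iO01 : ∀ ω : Config E, ω e₁ = false →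
      (Function.update ω e₂ true ∈ O ↔ Function.update ω e₂ false ∈ O) :=
    fun ω hc => conn_update_e₂_iff ends e₁ e₂ a₂ v b a₂ o h1 h2 hdeg he hba.symm hbo.symm ω hc
  have iW01 : ∀ ω : Config E, ω e₁ = false →
      (Function.update ω e₂ true ∈ W ↔ Function.update ω e₂ false ∈ W) :=
    fun ω hc => conn_update_e₂_iff ends e₁ e₂ a₂ v b v o h1 h2 hdeg he hbv.symm hbo.symm ω hc
  have iB01 : ∀ ω : Config E, ω e₁ = false →
      (Function.update ω e₂ true ∈ B ↔ Function.update ω e₂ false ∈ F) := by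
    intro ω hc
    have hbv' : Conn ends (Function.update ω e₂ true) b v :=
      conn_of_openAdj ⟨e₂, by simp, by rw [h2, Sym2.eq_swap]⟩
    have hFω := iF01 ω hc
    constructor
    · intro h; exact hFω.1 (conn_trans h hbv')
    · intro h; exact conn_trans (hFω.2 h) (conn_symm hbv')
  have iO11 : ∀ ω : Config E, ω e₂ = true →
      (Function.update ω e₁ true ∈ O ↔ Function.update ω e₁ false ∈ O ∪ W) :=
    fun ω ho => conn_update_e₁_open_iff ends e₁ e₂ a₂ v b o h1 h2 hdeg he hbo hba hbv ω ho
  -- subsets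
  have hsubB : openEdge e₁ ⊆ B := openEdge_e₁_subset_connEvent ends e₁ a₂ b h1
  have hsubF : openEdge e₁ ∩ openEdge e₂ ⊆ F := openEdge_inter_subset_connEvent ends e₁ e₂ a₂ v b h1 h2
  have hsubB' : openEdge e₁ ∩ openEdge e₂ ⊆ B := fun ω hω => hsubB hω.1
  have hsubBF : openEdge e₁ ∩ openEdge e₂ ⊆ B ∩ F := fun ω hω => ⟨hsubB' hω, hsubF hω⟩
  -- world (1,0)
  have hF10 : prob P10 F = prob P00 F := prob_pin10_eq_pin00 p e₁ e₂ he iF10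
  have hO10 : prob P10 O = prob P00 O := prob_pin10_eq_pin00 p e₁ e₂ he iO10
  have hOF10 : prob P10 (O ∩ F) = prob P00 (O ∩ F) :=
    prob_pin10_eq_pin00 p e₁ e₂ he fun ω hc => and_congr (iO10 ω hc) (iF10 ω hc)
  have hR10 : prob P10 (Fᶜ ∩ W) = prob P00 (Fᶜ ∩ W) :=
    prob_pin10_eq_pin00 p e₁ e₂ he fun ω hc => and_congr (not_congr (iF10 ω hc)) (iW10 ω hc)
  have hcomm10 : P10 = Function.update (Function.update p e₂ (0 : R)) e₁ (1 : R) :=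
    Function.update_comm he (1 : R) (0 : R) p
  have hB10 : prob P10 B = 1 := by
    rw [hcomm10]
    exact prob_update_one_eq_one_of_subset _ (hp.update e₂ le_rfl zero_le_one) e₁ B hsubB
  have hOB10 : prob P10 (O ∩ B) = prob P00 O := by
    rw [hcomm10, prob_update_one_inter_eq_of_subset _ e₁ O B hsubB, ← hcomm10, hO10]
  have hBF10 : prob P10 (B ∩ F) = prob P00 F := by
    rw [Set.inter_comm, hcomm10, prob_update_one_inter_eq_of_subset _ e₁ F B hsubB, ← hcomm10, hF10]
  -- world (0,1)
  have hF01 : prob P01 F = prob P00 F := prob_pin01_eq_pin00 p e₁ e₂ he iF01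
  have hO01 : prob P01 O = prob P00 O := prob_pin01_eq_pin00 p e₁ e₂ he iO01
  have hOF01 : prob P01 (O ∩ F) = prob P00 (O ∩ F) :=
    prob_pin01_eq_pin00 p e₁ e₂ he fun ω hc => and_congr (iO01 ω hc) (iF01 ω hc)
  have hR01 : prob P01 (Fᶜ ∩ W) = prob P00 (Fᶜ ∩ W) :=
    prob_pin01_eq_pin00 p e₁ e₂ he fun ω hc => and_congr (not_congr (iF01 ω hc)) (iW01 ω hc)
  have hB01 : prob P01 B = prob P00 F := prob_pin01_eq_pin00 p e₁ e₂ he iB01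
  have hOB01 : prob P01 (O ∩ B) = prob P00 (O ∩ F) :=
    prob_pin01_eq_pin00 p e₁ e₂ he fun ω hc => and_congr (iO01 ω hc) (iB01 ω hc)
  have hBF01 : prob P01 (B ∩ F) = prob P00 F := by
    have := prob_pin01_eq_pin00 p e₁ e₂ he (A := B ∩ F) (A' := F ∩ F)
      fun ω hc => and_congr (iB01 ω hc) (iF01 ω hc)
    rwa [Set.inter_self] at this
  -- world (1,1)
  have hF11 : prob P11 F = 1 := pin11_eq_one_of_subset p hp e₁ e₂ he F hsubF
  have hB11 : prob P11 B = 1 := pin11_eq_one_of_subset p hp e₁ e₂ he B hsubB'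
  have hBF11 : prob P11 (B ∩ F) = 1 := pin11_eq_one_of_subset p hp e₁ e₂ he (B ∩ F) hsubBF
  have hO11 : prob P11 O = prob P00 (O ∪ W) := by
    rw [prob_pin11_eq_pin01 p e₁ e₂ he iO11]
    exact prob_pin01_eq_pin00 p e₁ e₂ he fun ω hc => or_congr (iO01 ω hc) (iW01 ω hc)
  have hOB11 : prob P11 (O ∩ B) = prob P00 (O ∪ W) := by
    rw [pin11_inter_eq_of_subset p e₁ e₂ he O B hsubB', hO11]
  have hOF11 : prob P11 (O ∩ F) = prob P00 (O ∪ W) := by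
    rw [pin11_inter_eq_of_subset p e₁ e₂ he O F hsubF, hO11]
  have hR11 : prob P11 (Fᶜ ∩ W) = 0 := by
    refine le_antisymm ?_ (prob_nonneg hp11 _)
    calc prob P11 (Fᶜ ∩ W) ≤ prob P11 Fᶜ := prob_inter_le_left hp11 _ _
      _ = 0 := by rw [prob_compl, hF11, sub_self]
  -- world (0,0)
  have hB00 : prob P00 B = 0 := pin00_B p ends e₁ e₂ a₂ b hdeg he hba
  have hOB00 : prob P00 (O ∩ B) = 0 :=
    le_antisymm (by rw [← hB00]; exact prob_inter_le_right hp00 _ _) (prob_nonneg hp00 _)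
  have hBF00 : prob P00 (B ∩ F) = 0 :=
    le_antisymm (by rw [← hB00]; exact prob_inter_le_left hp00 _ _) (prob_nonneg hp00 _)
  -- the merged mass splits: `P₀(O ∪ W) = P₀(O) + P₀(Fᶜ ∩ W)`
  have hε : prob P00 (O ∪ W) = prob P00 O + prob P00 (Fᶜ ∩ W) := by
    have h1' := prob_inter_add_prob_inter_compl P00 (O ∪ W) F
    have h2' := prob_inter_add_prob_inter_compl P00 O F
    rw [union_inter_conn_eq, prob_union_inter_compl_eq] at h1'
    linarith
  -- totals
  have tF := prob_eq_pin2 p e₁ e₂ he F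
  have tO := prob_eq_pin2 p e₁ e₂ he O
  have tB := prob_eq_pin2 p e₁ e₂ he B
  have tOB := prob_eq_pin2 p e₁ e₂ he (O ∩ B)
  have tOF := prob_eq_pin2 p e₁ e₂ he (O ∩ F)
  have tBF := prob_eq_pin2 p e₁ e₂ he (B ∩ F)
  have tR := prob_eq_pin2 p e₁ e₂ he (Fᶜ ∩ W)
  rw [← hP11, ← hP10, ← hP01, ← hP00] at tF tO tB tOB tOF tBF tR
  rw [hF11, hF10, hF01] at tF
  rw [hO11, hO10, hO01, hε] at tO
  rw [hB11, hB10, hB01, hB00] at tB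
  rw [hOB11, hOB10, hOB01, hOB00, hε] at tOB
  rw [hOF11, hOF10, hOF01, hε] at tOF
  rw [hBF11, hBF10, hBF01, hBF00] at tBF
  rw [hR11, hR10, hR01] at tR
  unfold zpp
  rw [prob_compl, tF, tO, tB, tOB, tOF, tBF, tR]
  ring

include hp in
/-- **`(Z″)` holds on the two-edge family** — every factor of the closed form is nonnegative, the
last by Harris for `E₀ = {o ↔ a₂} ∪ {o ↔ v}` and `F₀ = {v ↔ a₂}` under `p[e₁↦0][e₂↦0]`. -/
theorem zpp_two_edge_nonneg (h1 : ends e₁ = s(a₂, b)) (h2 : ends e₂ = s(v, b))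
    (hdeg : ∀ e, b ∈ ends e → e = e₁ ∨ e = e₂) (he : e₁ ≠ e₂) (hbo : b ≠ o) (hba : b ≠ a₂)
    (hbv : b ≠ v) : 0 ≤ zpp p ends v a₂ o b := by
  rw [zpp_two_edge_eq p hp ends e₁ e₂ a₂ v o b h1 h2 hdeg he hbo hba hbv]
  set P00 := Function.update (Function.update p e₁ (0 : R)) e₂ (0 : R) with hP00
  have hp00 : IsProbVec P00 := (hp.update e₁ le_rfl zero_le_one).update e₂ le_rfl zero_le_one
  have hβ0 := hp.nonneg e₁
  have hβ1 := hp.le_one e₁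
  have hδ0 := hp.nonneg e₂
  have hδ1 := hp.le_one e₂
  have hs1 := prob_le_one hp00 (connEvent ends a₂ v)
  -- Harris for `E₀` and `F₀`
  have hH := prob_mul_prob_le_prob_inter hp00
    ((isUpperSet_connEvent ends a₂ o).union (isUpperSet_connEvent ends v o))
    (isUpperSet_connEvent ends a₂ v)
  rw [union_inter_conn_eq] at hH
  have hε : prob P00 (connEvent ends a₂ o ∪ connEvent ends v o) =
      prob P00 (connEvent ends a₂ o) + prob P00 ((connEvent ends a₂ v)ᶜ ∩ connEvent ends v o) := by
    have h1' := prob_inter_add_prob_inter_compl P00 (connEvent ends a₂ o ∪ connEvent ends v o)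
      (connEvent ends a₂ v)
    have h2' := prob_inter_add_prob_inter_compl P00 (connEvent ends a₂ o) (connEvent ends a₂ v)
    rw [union_inter_conn_eq, prob_union_inter_compl_eq] at h1'
    linarith
  rw [hε] at hH
  have hlast : 0 ≤ prob P00 (connEvent ends a₂ o ∩ connEvent ends a₂ v) -
      (prob P00 (connEvent ends a₂ o) + prob P00 ((connEvent ends a₂ v)ᶜ ∩ connEvent ends v o)) *
        prob P00 (connEvent ends a₂ v) := by linarith
  have hβδ : p e₁ * p e₂ ≤ 1 := by nlinarith
  have hmid : 0 ≤ 1 + p e₁ - p e₁ * p e₂ := by nlinarith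
  exact mul_nonneg (mul_nonneg (mul_nonneg (mul_nonneg (mul_nonneg (sub_nonneg.2 hβ1) hδ0) hmid)
    (sub_nonneg.2 hβδ)) (sub_nonneg.2 hs1)) hlast

end Main
end TwoEdgeThm

end RowC1

end Summit.Ventures.PercRepro2
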